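import Literature.MathematicalPhysics.QuantumFieldTheory.BalabanImbrieJaffe1984to88.BIJ88TrainsDsetExpansion306
import Literature.MathematicalPhysics.QuantumFieldTheory.BalabanImbrieJaffe1984to88.BIJ88PairingAllOrders5133

/-!
# `BalabanImbrieJaffe1984to88.BIJ88WalkTermCounting309` — T. Bałaban, J. Imbrie, A. Jaffe, *Effective action and cluster properties of the
abelian Higgs model*, Commun. Math. Phys. **114** (1988) 257–315 [BalabanImbrieJaffe1988]: p. 307 [PDF 51] L16 and L20–23 (Sect. 5.13:
*"These control the sum over walks and partitions, and the factorials, as in [9]."*, *"Estimating the sums over S_γ, S_5, and the sums in the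
cluster expansion leads to combinatoric factors exp((e^β(L^kε/ε₀)^{1/4−α})^{β′}|X_a|), β′ > 0. Such factors are easily beaten by the small factors described above for
nonexceptional cubes"*) — **THE CRUDE COUNTS OF THE WALK EXPANSION OF ONE POLYMER**: how many vertex structures `σ ∈ smallParts X`, groupings
`P ∈ setPartitions σ`, end data `E` and slot assignments `g` of the legs the master bound `BIJ88LocatedActivityBound309.abs_actIn_le_master` sums
over, as functions of the number of cubes `|X|`, of sites and of located slots — the bookkeeping inputs of a BOUNDED-SIZE instance of the located
(5.14.4) (the per-cube, volume-uniform control *"as in [9]"* is a different, finer argument, not attempted here).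
* §1 `card_le_of_isSetPartition` (a set partition has at most `|V|` blocks), `card_setPartitions_le`, `card_smallParts_le` (`≤ 2^{2^{|X|}}`),
  `length_toList_le` (the trains of a grouping: `|P| ≤ |X|`), `toList_length_pos`;
* §2 `card_trainLegs_le` (`≤ 2·#trains`), `inner_mem_trainLegs`, `trainLegs_nonempty` (every train has its inner leg);
  `card_asg_le` (assignments `≤ G^{#leg slots}`), `card_endData` (end data `= (n + n²)^{#trains}`, `n` = sites);
* §3 `prod_attach_filter` (the hit-set products of `BIJ88TermHitShellBound309` as plain filtered products), `prod_le_pow_of_le`,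
  `sum_le_card_mul` (real-valued `Σ ≤ |s|·bound`);
* §4 `prod_le_prod_mul_of_special`, `slots_mul_shells_le` (**the slot bookkeeping of one term** of the master bound
  `BIJ88LocatedActivityBound309.abs_actIn_le_master` under BOUNDED letters: hit χ-slots `t^{m}A ≤ Aχ` with shells `≤ (t e_k)^M θS`, free χ-slots
  `≤ 1`, `V`-slots `≤ AV θV^{m+n}`, one leg-carrying slot paying `ε θ^{β′N₀}`), `ends_le` (train ends `≤ K₁^{N₀}`).

statement-level skeleton of published theorems with citation tags; proofs where landed; nothing here is a claim about the Yang–Mills mass gap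

PDF held: `paper:balaban1988-cmp114-bij-abelian-higgs-effective-action` (journal page = PDF page + 256); page re-read this session as text:
PDF 51 (p. 307) L14–23.

CITATION HEADER (lean-in-tree rule).  Part of the lit-balaban TYPED SKELETON (HOME `run/shared/lean/pub/lit-balaban/`), Phase 2, seat p36
(gen 22, unit `lit-balaban-p36`); row **C2.Eq5.14.3-5.14.4** (member: §f assembly, counting inputs E4e for the bounded-size instance) of
`HOME/lit-balaban-r16/ROWS-C2-part2.md` (owner r16, referee ref-5).  Theorem-only (folklore finite combinatorics around the tree's `smallParts`,
`setPartitions`, `trainLegs`); no definitions, no `Prop` facts; axioms standard.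

REVISION (doc-only, owner item D-owner-v2.371 / referee ref-5 g83): the p. 307 quotations in the module docstring (L22–25: print's
«exp((e^β(L^kε/ε₀)^{1/4−α})^{β′}|X_a|), β′ > 0») and in the docstring of `slots_mul_shells_le` (L2–12, print's factors «e^β(L^kε/ε₀)^{1/4−α}»,
«e^{−cp(e_k)²}», «e^{−cr(e_k)}») are now verbatim; no declaration changed.
-/

namespace Literature.MathematicalPhysics.QuantumFieldTheory.BalabanImbrieJaffe1984to88.BIJ88WalkTermCounting309

open Finset
open scoped BigOperators
open Literature.Probability.LatticeModels (setPartitions IsSetPartition mem_setPartitions)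
open BIJ88PairingAllOrders5133 (smallParts mem_smallParts)
open BIJ88TrainsDsetExpansion306 (trainLegs legsAt)

/-! ## §1  Vertex structures and groupings -/

section Partitions

variable {I : Type} [DecidableEq I]

/-- a set partition of `V` has at most `|V|` blocks (blocks are nonempty and their sizes add up to `|V|`). [folklore]
[cite: BalabanImbrieJaffe1988, §5.13 p.307] -/
theorem card_le_of_isSetPartition {V : Finset I} {π : Finset (Finset I)} (h : IsSetPartition V π) : π.card ≤ V.card := by
  calc π.card = ∑ P ∈ π, 1 := by simp
    _ ≤ ∑ P ∈ π, P.card := sum_le_sum fun P hP => (h.nonempty_of_mem hP).card_pos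
    _ = V.card := h.sum_card

/-- `|setPartitions V| ≤ 2^{2^{|V|}}` (every partition is a set of subsets). [folklore] [cite: BalabanImbrieJaffe1988, §5.13 p.307] -/
theorem card_setPartitions_le (V : Finset I) : (setPartitions V).card ≤ 2 ^ 2 ^ V.card := by
  rw [setPartitions]
  exact (card_le_card (filter_subset _ _)).trans (by rw [card_powerset, card_powerset])

/-- `|smallParts X| ≤ 2^{2^{|X|}}` — the count of vertex structures of the walk expansion of the polymer `X` (p. 307: *"combinatoric factors"*).
[cite: BalabanImbrieJaffe1988, §5.13 p.307] -/
theorem card_smallParts_le (X : Finset I) : (smallParts X).card ≤ 2 ^ 2 ^ X.card :=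
  (card_le_card fun _ hσ => mem_setPartitions.2 (mem_smallParts.1 hσ).1).trans (card_setPartitions_le X)

/-- **a grouping of a vertex structure of `X` has at most `|X|` trains**: `|P| ≤ |σ| ≤ |X|`. [cite: BalabanImbrieJaffe1988, §5.13 p.307] -/
theorem length_toList_le {X : Finset I} {σ : Finset (Finset I)} (hσ : σ ∈ smallParts X) {P : Finset (Finset (Finset I))}
    (hP : P ∈ setPartitions σ) : P.toList.length ≤ X.card := by
  rw [length_toList]
  exact (card_le_of_isSetPartition (mem_setPartitions.1 hP)).trans (card_le_of_isSetPartition (mem_smallParts.1 hσ).1)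

/-- a grouping of a vertex structure of a nonempty polymer has at least one train. [cite: BalabanImbrieJaffe1988, §5.13 p.307] -/
theorem toList_length_pos {X : Finset I} (hX : X.Nonempty) {σ : Finset (Finset I)} (hσ : σ ∈ smallParts X)
    {P : Finset (Finset (Finset I))} (hP : P ∈ setPartitions σ) : 0 < P.toList.length := by
  rw [length_toList, card_pos]
  obtain ⟨i, hi⟩ := hX
  obtain ⟨B, hB, -⟩ := (mem_smallParts.1 hσ).1.exists_mem hi
  obtain ⟨Q, hQ, -⟩ := (mem_setPartitions.1 hP).exists_mem hB
  exact ⟨Q, hQ⟩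

/-- `|setPartitions σ| ≤ 2^{2^{|X|}}` for a vertex structure `σ` of `X`. [cite: BalabanImbrieJaffe1988, §5.13 p.307] -/
theorem card_setPartitions_smallParts_le {X : Finset I} {σ : Finset (Finset I)} (hσ : σ ∈ smallParts X) :
    (setPartitions σ).card ≤ 2 ^ 2 ^ X.card :=
  (card_setPartitions_le σ).trans (Nat.pow_le_pow_right (by norm_num)
    (Nat.pow_le_pow_right (by norm_num) (card_le_of_isSetPartition (mem_smallParts.1 hσ).1)))

end Partitions

/-! ## §2  Legs, assignments, end data -/

section Legs

variable {S : Type}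

/-- **at most two legs per train**: `|trainLegs E| ≤ 2·#trains`. [cite: BalabanImbrieJaffe1988, §5.13 Eq. (5.13.3) p.306] -/
theorem card_trainLegs_le {m : ℕ} (E : Fin m → S ⊕ (S × S)) : (trainLegs E).card ≤ 2 * m := by
  calc (trainLegs E).card ≤ (univ : Finset (Fin m ×ₗ Fin 2)).card := card_le_univ _
    _ = 2 * m := by rw [Finset.card_univ, Fintype.card_lex, Fintype.card_prod, Fintype.card_fin, Fintype.card_fin, mul_comm]

/-- the inner leg `(k,1)` of every train is a leg. [cite: BalabanImbrieJaffe1988, §5.13 Eq. (5.13.3) p.306] -/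
theorem inner_mem_trainLegs {m : ℕ} (E : Fin m → S ⊕ (S × S)) (k : Fin m) : toLex (k, (1 : Fin 2)) ∈ trainLegs E := by
  rw [trainLegs, mem_biUnion]
  refine ⟨k, mem_univ _, ?_⟩
  unfold legsAt
  cases E k <;> simp

/-- a nonempty product of trains has a leg. [cite: BalabanImbrieJaffe1988, §5.13 Eq. (5.13.3) p.306] -/
theorem trainLegs_nonempty {m : ℕ} (hm : 0 < m) (E : Fin m → S ⊕ (S × S)) : (trainLegs E).Nonempty :=
  ⟨_, inner_mem_trainLegs E ⟨0, hm⟩⟩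

/-- **the number of slot assignments**: parking the non-legs at `τ₀` and letting the legs range over a slot set of at most `G ≥ 1` slots,
`#assignments ≤ G^{#leg slots}`. [cite: BalabanImbrieJaffe1988, §5.13 p.307] -/
theorem card_asg_le {κ σ : Type} [Fintype κ] [DecidableEq κ] [DecidableEq σ] (T : Finset σ) (τ₀ : σ) (D : Finset κ) {G : ℕ}
    (hT : T.card ≤ G) (hG : 1 ≤ G) :
    (Fintype.piFinset fun j => if j ∈ D then T else {τ₀}).card ≤ G ^ Fintype.card κ := by
  rw [Fintype.card_piFinset, ← Finset.card_univ, ← prod_const]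
  refine prod_le_prod (fun j _ => Nat.zero_le _) fun j _ => ?_
  split_ifs
  · exact hT
  · rw [card_singleton]; exact hG

/-- **the number of end data** of `n` trains on `ns` sites: `(ns + ns²)^n` (each train ends in the source at a site or in a second derivative
at a pair of sites). [cite: BalabanImbrieJaffe1988, §5.13 Eq. (5.13.3) p.306] -/
theorem card_endData (S : Type) [Fintype S] [DecidableEq S] (n : ℕ) :
    Fintype.card (Fin n → S ⊕ (S × S)) = (Fintype.card S + Fintype.card S ^ 2) ^ n := by
  rw [Fintype.card_fun, Fintype.card_fin, Fintype.card_sum, Fintype.card_prod, sq]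

end Legs

/-! ## §3  Small real-valued bookkeeping helpers -/

section Helpers

/-- a product over a filtered `attach` is the plain filtered product (the hit-set products of `BIJ88TermHitShellBound309`). [folklore]
[cite: BalabanImbrieJaffe1988, §5.13 p.307] -/
theorem prod_attach_filter {β M : Type*} [CommMonoid M] (s : Finset β) (Q : β → Prop) [DecidablePred Q] (f : β → M) :
    ∏ x ∈ s.attach.filter (fun x => Q x.1), f x.1 = ∏ x ∈ s.filter Q, f x := by
  rw [prod_filter, prod_filter]
  exact prod_attach s (fun x => if Q x then f x else 1)

/-- `Π_{x∈s} f x ≤ b^{|s|}` for `0 ≤ f ≤ b`. [folklore] [cite: BalabanImbrieJaffe1988, §5.13 p.307] -/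
theorem prod_le_pow_of_le {β : Type*} (s : Finset β) {f : β → ℝ} {b : ℝ} (h0 : ∀ x ∈ s, 0 ≤ f x) (h1 : ∀ x ∈ s, f x ≤ b) :
    ∏ x ∈ s, f x ≤ b ^ s.card := by
  rw [← prod_const]
  exact prod_le_prod h0 h1

/-- `Σ_{x∈s} f x ≤ |s|·b` for `f ≤ b` on `s`. [folklore] [cite: BalabanImbrieJaffe1988, §5.13 p.307] -/
theorem sum_le_card_mul {β : Type*} (s : Finset β) {f : β → ℝ} {b : ℝ} (h : ∀ x ∈ s, f x ≤ b) : ∑ x ∈ s, f x ≤ s.card * b := by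
  refine (sum_le_card_nsmul s f b h).trans (le_of_eq ?_)
  rw [nsmul_eq_mul]

/-- monotonicity of `N ↦ C·N` bounds: `|s|·b ≤ N·b` for `|s| ≤ N`, `0 ≤ b`. [folklore] [cite: BalabanImbrieJaffe1988, §5.13 p.307] -/
theorem card_mul_le_of_card_le {β : Type*} (s : Finset β) {N : ℕ} (hs : s.card ≤ N) {b : ℝ} (hb : 0 ≤ b) :
    (s.card : ℝ) * b ≤ (N : ℝ) * b :=
  mul_le_mul_of_nonneg_right (by exact_mod_cast hs) hb

end Helpers

/-! ## §4  The letters of one term: slots with shells, and train ends -/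

section Term
/-- a product with one special factor: `0 ≤ f ≤ g` on `s`, `f a ≤ g a · c` at `a ∈ s` (`0 ≤ c`, `0 ≤ g`) ⇒ `Π f ≤ (Π g) · c` — how ONE
distinguished slot (the one a leg lands on) contributes its small factor while the others contribute their sizes. [folklore]
[cite: BalabanImbrieJaffe1988, §5.13 p.307] -/
theorem prod_le_prod_mul_of_special {β : Type*} [DecidableEq β] (s : Finset β) {f g : β → ℝ} {a : β} (ha : a ∈ s) {c : ℝ}
    (hc : 0 ≤ c) (hf0 : ∀ x ∈ s, 0 ≤ f x) (hg0 : ∀ x ∈ s, 0 ≤ g x) (hfg : ∀ x ∈ s, f x ≤ g x) (hfa : f a ≤ g a * c) :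
    ∏ x ∈ s, f x ≤ (∏ x ∈ s, g x) * c := by
  rw [← mul_prod_erase s f ha, ← mul_prod_erase s g ha]
  have h1 : ∏ x ∈ s.erase a, f x ≤ ∏ x ∈ s.erase a, g x :=
    prod_le_prod (fun x hx => hf0 x (mem_of_mem_erase hx)) fun x hx => hfg x (mem_of_mem_erase hx)
  have h2 : 0 ≤ ∏ x ∈ s.erase a, f x := prod_nonneg fun x hx => hf0 x (mem_of_mem_erase hx)
  calc f a * ∏ x ∈ s.erase a, f x ≤ (g a * c) * ∏ x ∈ s.erase a, g x :=
        mul_le_mul hfa h1 h2 (mul_nonneg (hg0 a ha) hc)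
    _ = g a * (∏ x ∈ s.erase a, g x) * c := by ring

/-- **THE SLOT BOOKKEEPING OF ONE TERM OF THE MASTER BOUND** (abstract letters; p. 307 L2–12: *"we get a factor e^β(L^kε/ε₀)^{1/4−α} or
e^{−cr(e_k)}"*, *"produce factors e^{−cp(e_k)²}"*, *"so we get small factors e^{−cr(e_k)} from the exponential decay of the operators C_s and Δ
in C_ω(α)"*): located χ-slots `b ∈ Bloc` with slot values `sv (inl b)` (`t^{m_b}·sv ≤ Aχ` when hit by `t` or a leg, `≤ 1` when free) and
shell factors `0 ≤ S_b ≤ (t e_k)^M·θS` on the hit ones, located `V`-slots `Y ∈ Yloc` with `sv (inr Y) ≤ AV·θV^{m_Y+n_Y}`, `t`-counts `m ≤ M`, and a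
distinguished located slot `τs` carrying a leg (`n_{τs} ≠ 0`): the product of the slot values and the shells is at most
`Aχ^{|Bloc|}·AV^{|Yloc|}·θ^{Σ_τ m_τ}·(ε θ^{β′N₀})` once `e_k ≤ θ ≤ 1`, `θV ≤ θ`, `θS, θV ≤ ε θ^{β′N₀}`. [cite: BalabanImbrieJaffe1988, §5.13 p.307 L2–12] -/
theorem slots_mul_shells_le {β υ : Type*} [DecidableEq β] [DecidableEq υ] (Bloc : Finset β) (Yloc : Finset υ)
    (m n : β ⊕ υ → ℕ) (sv : β ⊕ υ → ℝ) (S : β → ℝ) {t ek θ θS θV Aχ AV ε β' : ℝ} {M N₀ : ℕ}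
    (ht0 : 0 < t) (ht1 : t ≤ 1) (hek0 : 0 ≤ ek) (hekθ : ek ≤ θ) (hθ1 : θ ≤ 1)
    (hθS0 : 0 ≤ θS) (hθS1 : θS ≤ 1) (hθV0 : 0 ≤ θV) (hθVθ : θV ≤ θ) (hAχ : 1 ≤ Aχ) (hAV : 1 ≤ AV) (hε : 0 ≤ ε)
    (hSε : θS ≤ ε * θ ^ (β' * (N₀ : ℝ))) (hVε : θV ≤ ε * θ ^ (β' * (N₀ : ℝ)))
    (hsv0 : ∀ τ, 0 ≤ sv τ)
    (hsvχ : ∀ b ∈ Bloc, (m (Sum.inl b) ≠ 0 ∨ n (Sum.inl b) ≠ 0) → t ^ m (Sum.inl b) * sv (Sum.inl b) ≤ Aχ)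
    (hsvχ0 : ∀ b ∈ Bloc, m (Sum.inl b) = 0 → n (Sum.inl b) = 0 → sv (Sum.inl b) ≤ 1)
    (hsvV : ∀ Y ∈ Yloc, sv (Sum.inr Y) ≤ AV * θV ^ (m (Sum.inr Y) + n (Sum.inr Y)))
    (hS0 : ∀ b ∈ Bloc, 0 ≤ S b) (hS : ∀ b ∈ Bloc, S b ≤ (t * ek) ^ M * θS) (hmM : ∀ τ, m τ ≤ M)
    (τs : β ⊕ υ) (hτs : τs ∈ Bloc.disjSum Yloc) (hnτs : n τs ≠ 0) :
    (∏ τ ∈ Bloc.disjSum Yloc, sv τ) * ∏ b ∈ Bloc.filter (fun b => m (Sum.inl b) ≠ 0 ∨ n (Sum.inl b) ≠ 0), S b ≤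
      Aχ ^ Bloc.card * AV ^ Yloc.card * θ ^ (∑ τ ∈ Bloc.disjSum Yloc, m τ) * (ε * θ ^ (β' * (N₀ : ℝ))) := by
  have hθ0 : 0 ≤ θ := hek0.trans hekθ
  have hek1 : ek ≤ 1 := hekθ.trans hθ1
  -- the χ-part with the shells merged: factor `f b = sv (inl b) · (S b if hit, 1 if free)`
  set f : β → ℝ := fun b => sv (Sum.inl b) * if m (Sum.inl b) ≠ 0 ∨ n (Sum.inl b) ≠ 0 then S b else 1 with hf
  have hmerge : (∏ b ∈ Bloc, sv (Sum.inl b)) * ∏ b ∈ Bloc.filter (fun b => m (Sum.inl b) ≠ 0 ∨ n (Sum.inl b) ≠ 0), S b =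
      ∏ b ∈ Bloc, f b := by
    rw [prod_filter, ← prod_mul_distrib]
  have hf0 : ∀ b ∈ Bloc, 0 ≤ f b := fun b hb => by
    simp only [hf]
    split_ifs
    · exact mul_nonneg (hsv0 _) (hS0 b hb)
    · rw [mul_one]; exact hsv0 _
  -- each χ-factor is at most `Aχ θ^{m}`, and a hit one at most `Aχ θ^{m} θS`
  have hhit : ∀ b ∈ Bloc, (m (Sum.inl b) ≠ 0 ∨ n (Sum.inl b) ≠ 0) → f b ≤ Aχ * θ ^ m (Sum.inl b) * θS := by
    intro b hb hh
    simp only [hf, if_pos hh]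
    have hm := hmM (Sum.inl b)
    have h1 : sv (Sum.inl b) * S b ≤ sv (Sum.inl b) * ((t * ek) ^ M * θS) := mul_le_mul_of_nonneg_left (hS b hb) (hsv0 _)
    have h2 : sv (Sum.inl b) * ((t * ek) ^ M * θS) = (t ^ m (Sum.inl b) * sv (Sum.inl b)) * (t ^ (M - m (Sum.inl b)) * ek ^ M) * θS := by
      rw [mul_pow]
      have : t ^ M = t ^ m (Sum.inl b) * t ^ (M - m (Sum.inl b)) := by rw [← pow_add, Nat.add_sub_cancel' hm]
      rw [this]; ring
    have h3 : t ^ (M - m (Sum.inl b)) * ek ^ M ≤ θ ^ m (Sum.inl b) := by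
      calc t ^ (M - m (Sum.inl b)) * ek ^ M ≤ 1 * ek ^ m (Sum.inl b) :=
            mul_le_mul (pow_le_one₀ ht0.le ht1) (pow_le_pow_of_le_one hek0 hek1 hm) (pow_nonneg hek0 _) zero_le_one
        _ ≤ θ ^ m (Sum.inl b) := by rw [one_mul]; exact pow_le_pow_left₀ hek0 hekθ _
    calc sv (Sum.inl b) * S b ≤ (t ^ m (Sum.inl b) * sv (Sum.inl b)) * (t ^ (M - m (Sum.inl b)) * ek ^ M) * θS := by rw [← h2]; exact h1
      _ ≤ Aχ * θ ^ m (Sum.inl b) * θS :=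
          mul_le_mul_of_nonneg_right (mul_le_mul (hsvχ b hb hh) h3 (by positivity) (zero_le_one.trans hAχ)) hθS0
  have hall : ∀ b ∈ Bloc, f b ≤ Aχ * θ ^ m (Sum.inl b) := by
    intro b hb
    by_cases hh : m (Sum.inl b) ≠ 0 ∨ n (Sum.inl b) ≠ 0
    · exact (hhit b hb hh).trans (mul_le_of_le_one_right (by positivity) hθS1)
    · have hm0 : m (Sum.inl b) = 0 := by by_contra h'; exact hh (Or.inl h')
      have hn0 : n (Sum.inl b) = 0 := by by_contra h'; exact hh (Or.inr h')
      simp only [hf]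
      rw [if_neg hh, mul_one, hm0, pow_zero, mul_one]
      exact (hsvχ0 b hb hm0 hn0).trans hAχ
  have hχprod : ∏ b ∈ Bloc, Aχ * θ ^ m (Sum.inl b) = Aχ ^ Bloc.card * θ ^ ∑ b ∈ Bloc, m (Sum.inl b) := by
    rw [prod_mul_distrib, prod_const, prod_pow_eq_pow_sum]
  -- the `V`-part: each factor at most `AV θ^{m}`, and one carrying a leg at most `AV θ^{m} θV`
  have hVall : ∀ Y ∈ Yloc, sv (Sum.inr Y) ≤ AV * θ ^ m (Sum.inr Y) := by
    intro Y hY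
    refine (hsvV Y hY).trans (mul_le_mul_of_nonneg_left ?_ (zero_le_one.trans hAV))
    rw [pow_add]
    exact (mul_le_of_le_one_right (pow_nonneg hθV0 _) (pow_le_one₀ hθV0 (hθVθ.trans hθ1))).trans
      (pow_le_pow_left₀ hθV0 hθVθ _)
  have hVhit : ∀ Y ∈ Yloc, n (Sum.inr Y) ≠ 0 → sv (Sum.inr Y) ≤ AV * θ ^ m (Sum.inr Y) * θV := by
    intro Y hY hn
    refine (hsvV Y hY).trans ?_
    rw [pow_add, ← mul_assoc]
    refine mul_le_mul ?_ ?_ (pow_nonneg hθV0 _) (by positivity)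
    · exact mul_le_mul_of_nonneg_left (pow_le_pow_left₀ hθV0 hθVθ _) (zero_le_one.trans hAV)
    · obtain ⟨k, hk⟩ := Nat.exists_eq_succ_of_ne_zero hn
      rw [hk, pow_succ]
      exact mul_le_of_le_one_left hθV0 (pow_le_one₀ hθV0 (hθVθ.trans hθ1))
  have hVprod : ∏ Y ∈ Yloc, AV * θ ^ m (Sum.inr Y) = AV ^ Yloc.card * θ ^ ∑ Y ∈ Yloc, m (Sum.inr Y) := by
    rw [prod_mul_distrib, prod_const, prod_pow_eq_pow_sum]
  -- assemble according to where the distinguished leg sits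
  rw [prod_disjSum, sum_disjSum, mul_assoc, mul_comm (∏ Y ∈ Yloc, sv (Sum.inr Y)), ← mul_assoc, hmerge, pow_add]
  have hχle : ∏ b ∈ Bloc, f b ≤ Aχ ^ Bloc.card * θ ^ ∑ b ∈ Bloc, m (Sum.inl b) := by
    rw [← hχprod]; exact prod_le_prod hf0 hall
  have hVle : ∏ Y ∈ Yloc, sv (Sum.inr Y) ≤ AV ^ Yloc.card * θ ^ ∑ Y ∈ Yloc, m (Sum.inr Y) := by
    rw [← hVprod]; exact prod_le_prod (fun Y _ => hsv0 _) hVall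
  have hsmall0 : 0 ≤ ε * θ ^ (β' * (N₀ : ℝ)) := mul_nonneg hε (Real.rpow_nonneg hθ0 _)
  rcases mem_disjSum.1 hτs with ⟨b, hb, rfl⟩ | ⟨Y, hY, rfl⟩
  · -- the leg lands on the χ-slot `b`: its shell pays
    have hχle' : ∏ b ∈ Bloc, f b ≤ Aχ ^ Bloc.card * θ ^ (∑ b ∈ Bloc, m (Sum.inl b)) * θS := by
      rw [← hχprod]
      exact prod_le_prod_mul_of_special Bloc hb hθS0 hf0 (fun x _ => by positivity) hall (hhit b hb (Or.inr hnτs))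
    calc (∏ b ∈ Bloc, f b) * ∏ Y ∈ Yloc, sv (Sum.inr Y)
        ≤ (Aχ ^ Bloc.card * θ ^ (∑ b ∈ Bloc, m (Sum.inl b)) * θS) * (AV ^ Yloc.card * θ ^ ∑ Y ∈ Yloc, m (Sum.inr Y)) :=
          mul_le_mul hχle' hVle (prod_nonneg fun Y _ => hsv0 _) (by positivity)
      _ = Aχ ^ Bloc.card * AV ^ Yloc.card * (θ ^ (∑ b ∈ Bloc, m (Sum.inl b)) * θ ^ ∑ Y ∈ Yloc, m (Sum.inr Y)) * θS := by ring
      _ ≤ Aχ ^ Bloc.card * AV ^ Yloc.card * (θ ^ (∑ b ∈ Bloc, m (Sum.inl b)) * θ ^ ∑ Y ∈ Yloc, m (Sum.inr Y)) *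
            (ε * θ ^ (β' * (N₀ : ℝ))) := mul_le_mul_of_nonneg_left hSε (by positivity)
  · -- the leg lands on the `V`-slot `Y`: its letter pays
    have hVle' : ∏ Y ∈ Yloc, sv (Sum.inr Y) ≤ AV ^ Yloc.card * θ ^ (∑ Y ∈ Yloc, m (Sum.inr Y)) * θV := by
      rw [← hVprod]
      exact prod_le_prod_mul_of_special Yloc hY hθV0 (fun Y _ => hsv0 _) (fun x _ => by positivity) hVall (hVhit Y hY hnτs)
    calc (∏ b ∈ Bloc, f b) * ∏ Y ∈ Yloc, sv (Sum.inr Y)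
        ≤ (Aχ ^ Bloc.card * θ ^ (∑ b ∈ Bloc, m (Sum.inl b))) * (AV ^ Yloc.card * θ ^ (∑ Y ∈ Yloc, m (Sum.inr Y)) * θV) :=
          mul_le_mul hχle hVle' (prod_nonneg fun Y _ => hsv0 _) (by positivity)
      _ = Aχ ^ Bloc.card * AV ^ Yloc.card * (θ ^ (∑ b ∈ Bloc, m (Sum.inl b)) * θ ^ ∑ Y ∈ Yloc, m (Sum.inr Y)) * θV := by ring
      _ ≤ Aχ ^ Bloc.card * AV ^ Yloc.card * (θ ^ (∑ b ∈ Bloc, m (Sum.inl b)) * θ ^ ∑ Y ∈ Yloc, m (Sum.inr Y)) *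
            (ε * θ ^ (β' * (N₀ : ℝ))) := mul_le_mul_of_nonneg_left hVε (by positivity)

/-- **THE END SIZES OF ONE TERM** (p. 307 L9–13: *"small factors at each end of C_ω(α)"*, here only BOUNDED: every certified train end at most `K₁`
once `κ_c ≤ K₁` and the sitewise source letter has `|sites|·F₀ ≤ 1`), at most `N₀` trains: `Π_k (end size) ≤ K₁^{N₀}`.
[cite: BalabanImbrieJaffe1988, §5.13 p.307 L9–13] -/
theorem ends_le {S : Type*} [Fintype S] {n N₀ : ℕ} (hn : n ≤ N₀) {κc : Fin n → S → S → ℝ} {Fq : S → ℝ} {K₁ F₀ : ℝ}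
    (hK1 : 1 ≤ K₁) (hκ0 : ∀ k x y, 0 ≤ κc k x y) (hκ : ∀ k x y, κc k x y ≤ K₁) (hF0 : ∀ y, 0 ≤ Fq y) (hF : ∀ y, Fq y ≤ F₀)
    (hvol : (Fintype.card S : ℝ) * F₀ ≤ 1) (E : Fin n → S ⊕ (S × S)) :
    ∏ k, Sum.elim (fun x => ∑ y, κc k x y * Fq y) (fun xy => (1 / 2 : ℝ) * κc k xy.1 xy.2) (E k) ≤ K₁ ^ N₀ := by
  have hK0 : 0 ≤ K₁ := zero_le_one.trans hK1
  have hend : ∀ k, Sum.elim (fun x => ∑ y, κc k x y * Fq y) (fun xy => (1 / 2 : ℝ) * κc k xy.1 xy.2) (E k) ≤ K₁ := by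
    intro k
    cases E k with
    | inl x =>
        simp only [Sum.elim_inl]
        calc ∑ y, κc k x y * Fq y ≤ ∑ _y : S, K₁ * F₀ :=
              sum_le_sum fun y _ => mul_le_mul (hκ k x y) (hF y) (hF0 y) hK0
          _ = K₁ * ((Fintype.card S : ℝ) * F₀) := by rw [sum_const, card_univ, nsmul_eq_mul]; ring
          _ ≤ K₁ * 1 := mul_le_mul_of_nonneg_left hvol hK0
          _ = K₁ := mul_one _
    | inr xy =>
        simp only [Sum.elim_inr]
        calc (1 / 2 : ℝ) * κc k xy.1 xy.2 ≤ 1 * K₁ := mul_le_mul (by norm_num) (hκ k _ _) (hκ0 k _ _) zero_le_one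
          _ = K₁ := one_mul _
  have hend0 : ∀ k, 0 ≤ Sum.elim (fun x => ∑ y, κc k x y * Fq y) (fun xy => (1 / 2 : ℝ) * κc k xy.1 xy.2) (E k) := by
    intro k
    cases E k with
    | inl x => exact sum_nonneg fun y _ => mul_nonneg (hκ0 k x y) (hF0 y)
    | inr xy => exact mul_nonneg (by norm_num) (hκ0 k _ _)
  calc ∏ k, Sum.elim (fun x => ∑ y, κc k x y * Fq y) (fun xy => (1 / 2 : ℝ) * κc k xy.1 xy.2) (E k)
      ≤ K₁ ^ (univ : Finset (Fin n)).card := by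
        rw [← prod_const]; exact prod_le_prod (fun k _ => hend0 k) fun k _ => hend k
    _ ≤ K₁ ^ N₀ := by
        rw [card_univ, Fintype.card_fin]
        exact pow_le_pow_right₀ hK1 hn

end Term

end Literature.MathematicalPhysics.QuantumFieldTheory.BalabanImbrieJaffe1984to88.BIJ88WalkTermCounting309
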